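import Literature.Computability.Complexity.GraphCanonizationProgramFPStep
import Literature.Computability.Complexity.GraphCanonizationProgramCodes
import Literature.Computability.Complexity.CodeFPStringKit
import HarnessLib

/-!
# The canoniser as a list program, VII: the program on the padded code

The string program behind `babaiLuks1983_canonicalForm_holds`, as typed maps on the decoded
padded input `s = (pad, ((k, bits), (n, cols)))` (`CGProg.PIn`, code `pinE = pairE strE ginE`, so that
`pinE s = spad 18 (colGraphCode k G col)` on a genuine input):

* `rowsOf s` — the adjacency bits cut into `n` rows (`strChunks`); `validB s` — the rows form a
  symmetric irreflexive `n × n` matrix and there are `n` colours (`validB_iff`);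
* `initOf s` — the starting configuration `[classifyL n rows 1ⁿ (refineL …)]`; `stepOf s` — one
  transition of the list machine if the input is valid, the identity otherwise (so that the size
  invariant of the genuine run is all the final assembly needs); `headOrd` — the ordering returned
  by a finished configuration; `outOf'` — the output code data from an ordering;
* certificates `codeFP_rowsOf`, `codeFP_validB`, `codeFP_initOf`, `codeFP_stepOf`, `codeFP_headOrd`,
  `codeFP_outOf'`.

## References

* S. Arora, B. Barak, *Computational Complexity: A Modern Approach*, CUP 2009, §1.3, §2.6. [AroraBarakCC2009]
* B. Laubner, PhD thesis, HU Berlin 2011, doi:10.18452/16335, §3.4. [Laubner2011]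
-/

namespace Literature.Computability.Complexity

open _root_.Computability CodeFP Polynomial CGCanon

namespace CGProg

/-! ### The decoded input and the pieces of the program -/

/-- The decoded padded input: `(pad, ((k, bits), (n, cols)))`. [folklore] -/
abbrev PIn : Type := List Bool × GIn

/-- Its code. [folklore] -/
abbrev pinE : PIn → List Bool := pairE strE ginE

/-- The number of vertices (the unary header of the colour list). [folklore] -/
def nOf (s : PIn) : ℕ := s.2.2.1

/-- The rows of the adjacency matrix. [folklore] -/
def rowsOf (s : PIn) : List (List Bool) := chunksL (nOf s) s.2.1.2

/-- The colours. [folklore] -/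
def colsOf (s : PIn) : List ℕ := s.2.2.2

/-- The mask of the whole vertex set. [folklore] -/
def maskAll (n : ℕ) : List Bool := List.replicate n true

/-- Well-formed rows, as a test: all rows of length `n`, symmetric, zero diagonal. [folklore] -/
def rowsOKB (n : ℕ) (rows : List (List Bool)) : Bool :=
  (rows.all fun r => decide (r.length = n)) &&
    ((List.range n).all fun i => (List.range n).all fun j => decide (adjAt rows i j = adjAt rows j i)) &&
    ((List.range n).all fun i => !adjAt rows i i)

/-- **Validity of the decoded input.** [folklore] -/
def validB (s : PIn) : Bool := rowsOKB (nOf s) (rowsOf s) && decide ((colsOf s).length = nOf s)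

/-- The starting configuration. [folklore] -/
def initOf (s : PIn) : List LFrame :=
  [classifyL (nOf s) (rowsOf s) (maskAll (nOf s)) (refineL (nOf s) (rowsOf s) (maskAll (nOf s)) (colsOf s))]

/-- One guarded transition. [folklore] -/
def stepOf (s : PIn) (cfg : List LFrame) : List LFrame := if validB s then stepL (nOf s) (rowsOf s) cfg else cfg

/-- The ordering held by the top frame of a configuration (`[]` unless it is finished). [folklore] -/
def headOrd : List LFrame → List ℕ
  | [] => []
  | f :: _ => (tupleOf f).2.2.2.2.2.2.2.2.2

/-- The output data from an ordering: `((n, rows of the code flattened), (n, colours of the code))`. [folklore] -/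
def outOf' (s : PIn) (ord : List ℕ) : GIn :=
  ((nOf s, (codeL (rowsOf s) (colsOf s) ord).1.flatten), (nOf s, (codeL (rowsOf s) (colsOf s) ord).2))

/-! ### Semantics of the tests -/

/-- `chunksL n` has `n` blocks. [folklore] -/
@[simp] theorem length_chunksL (n : ℕ) (bits : List Bool) : (chunksL n bits).length = n := by simp [chunksL]

/-- `rowsOKB` decides `RowsOK` (for `n` rows). [folklore] -/
theorem rowsOKB_iff {n : ℕ} {rows : List (List Bool)} (hlen : rows.length = n) : rowsOKB n rows = true ↔ RowsOK n rows := by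
  simp only [rowsOKB, Bool.and_eq_true, List.all_eq_true, decide_eq_true_eq, List.mem_range, Bool.not_eq_true', RowsOK]
  exact ⟨fun ⟨⟨h1, h2⟩, h3⟩ => ⟨hlen, h1, fun i j hi hj => h2 i hi j hj, h3⟩, fun ⟨_, h1, h2, h3⟩ => ⟨⟨h1, fun i hi j hj => h2 i j hi hj⟩, h3⟩⟩

/-- **`validB` decides validity.** [folklore] -/
theorem validB_iff (s : PIn) : validB s = true ↔ RowsOK (nOf s) (rowsOf s) ∧ (colsOf s).length = nOf s := by
  rw [validB, Bool.and_eq_true, rowsOKB_iff (rows := rowsOf s) (length_chunksL _ _), decide_eq_true_iff]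

/-- The mask of the whole vertex set is `maskOf univ`. [folklore] -/
theorem maskAll_eq (n : ℕ) : maskAll n = maskOf (Finset.univ : Finset (Fin n)) := (maskOf_univ).symm

/-- `headOrd` of a finished configuration. [folklore] -/
@[simp] theorem headOrd_ret (o : List ℕ) : headOrd [LFrame.ret o] = o := rfl

/-! ### Certificates -/

/-- The unary header. [folklore] -/
theorem codeFP_nOf : CodeFP pinE unE nOf := (snd _ _).snd'.fst'

/-- The colours. [folklore] -/
theorem codeFP_colsOf : CodeFP pinE (rawE natE) colsOf := (snd _ _).snd'.snd'

/-- **The rows** (`strChunks`). [cite: AroraBarakCC2009, §1.3] -/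
theorem codeFP_rowsOf : CodeFP pinE (rawE strE) rowsOf :=
  (strChunks.comp (codeFP_nOf.pair (codeFP_nOf.pair (snd _ _).fst'.snd'))).congr fun _ => rfl

/-- The mask (`1ⁿ` is its own code). [folklore] -/
theorem codeFP_maskAll : CodeFP unE strE maskAll := transparent fun n => by
  change List.replicate n true = unE n
  rw [unE_eq_ones]

/-- **The validity test is typed polynomial time.** [cite: AroraBarakCC2009, §1.3] -/
theorem codeFP_validB : CodeFP pinE bitE validB := by
  -- rows of length `n`
  have hrl : CodeFP (pairE pinE strE) bitE (fun q => decide (q.2.length = nOf q.1)) :=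
    (eq unE_injective).comp ((strLength.comp (snd _ _)).pair (codeFP_nOf.comp (fst _ _)))
  have h1 : CodeFP pinE bitE (fun s => (rowsOf s).all fun r => decide (r.length = nOf s)) := ((all hrl).comp ((CodeFP.id _).pair codeFP_rowsOf)).congr fun _ => rfl
  -- symmetry: context `(s, i)`, item `j`
  let κ : (PIn × ℕ) × ℕ → List Bool := pairE (pairE pinE natE) natE
  have kr : CodeFP κ (rawE strE) (fun t => rowsOf t.1.1) := codeFP_rowsOf.comp (fst _ _).fst'
  have ki : CodeFP κ natE (fun t => t.1.2) := (fst _ _).snd'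
  have kj : CodeFP κ natE (fun t => t.2) := snd _ _
  have kij : CodeFP κ bitE (fun t => adjAt (rowsOf t.1.1) t.1.2 t.2) := (codeFP_adjAt.comp (kr.pair (ki.pair kj))).congr fun _ => rfl
  have kji : CodeFP κ bitE (fun t => adjAt (rowsOf t.1.1) t.2 t.1.2) := (codeFP_adjAt.comp (kr.pair (kj.pair ki))).congr fun _ => rfl
  have ksym : CodeFP κ bitE (fun t => decide (adjAt (rowsOf t.1.1) t.1.2 t.2 = adjAt (rowsOf t.1.1) t.2 t.1.2)) := (eq bitE_injective).comp (kij.pair kji)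
  have hrange1 : CodeFP (pairE pinE natE) (rawE natE) (fun q => List.range (nOf q.1)) := urange.comp (codeFP_nOf.comp (fst _ _))
  have hinner : CodeFP (pairE pinE natE) bitE (fun q => (List.range (nOf q.1)).all fun j => decide (adjAt (rowsOf q.1) q.2 j = adjAt (rowsOf q.1) j q.2)) :=
    ((all ksym).comp ((CodeFP.id _).pair hrange1)).congr fun _ => rfl
  have hrange : CodeFP pinE (rawE natE) (fun s => List.range (nOf s)) := urange.comp codeFP_nOf
  have h2 : CodeFP pinE bitE (fun s => (List.range (nOf s)).all fun i => (List.range (nOf s)).all fun j =>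
      decide (adjAt (rowsOf s) i j = adjAt (rowsOf s) j i)) := ((all hinner).comp ((CodeFP.id _).pair hrange)).congr fun _ => rfl
  -- zero diagonal
  have hdiag : CodeFP (pairE pinE natE) bitE (fun q => !adjAt (rowsOf q.1) q.2 q.2) :=
    ((codeFP_adjAt.comp ((codeFP_rowsOf.comp (fst _ _)).pair ((snd _ _).pair (snd _ _)))).congr fun _ => rfl).not
  have h3 : CodeFP pinE bitE (fun s => (List.range (nOf s)).all fun i => !adjAt (rowsOf s) i i) := ((all hdiag).comp ((CodeFP.id _).pair hrange)).congr fun _ => rfl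
  -- `n` colours
  have h4 : CodeFP pinE bitE (fun s => decide ((colsOf s).length = nOf s)) := (eq unE_injective).comp (((ulength natE).comp codeFP_colsOf).pair codeFP_nOf)
  exact (((h1.and h2).and h3).and h4).congr fun _ => rfl

/-- **The starting configuration is typed polynomial time.** [cite: AroraBarakCC2009, §1.3] -/
theorem codeFP_initOf : CodeFP pinE (rawE frameE) initOf := by
  have hm : CodeFP pinE strE (fun s => maskAll (nOf s)) := codeFP_maskAll.comp codeFP_nOf
  have href : CodeFP pinE (rawE natE) (fun s => refineL (nOf s) (rowsOf s) (maskAll (nOf s)) (colsOf s)) :=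
    (codeFP_refineL.comp ((codeFP_nOf.pair (codeFP_rowsOf.pair hm)).pair codeFP_colsOf)).congr fun _ => rfl
  have hcl : CodeFP pinE frameE (fun s => classifyL (nOf s) (rowsOf s) (maskAll (nOf s)) (refineL (nOf s) (rowsOf s) (maskAll (nOf s)) (colsOf s))) :=
    (codeFP_classifyL.comp ((codeFP_nOf.pair codeFP_rowsOf).pair (hm.pair href))).congr fun _ => rfl
  exact ((rawSingleton _).comp hcl).congr fun _ => rfl

/-- **The guarded transition is typed polynomial time**: input `(s, configuration)`. [cite: AroraBarakCC2009, §1.3] -/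
theorem codeFP_stepOf : CodeFP (pairE pinE (rawE frameE)) (rawE frameE) (fun t => stepOf t.1 t.2) := by
  have hstep : CodeFP (pairE pinE (rawE frameE)) (rawE frameE) (fun t => stepL (nOf t.1) (rowsOf t.1) t.2) :=
    (codeFP_stepL.comp (((codeFP_nOf.comp (fst _ _)).pair (codeFP_rowsOf.comp (fst _ _))).pair (snd _ _))).congr fun _ => rfl
  exact ((codeFP_validB.comp (fst _ _)).ite hstep (snd _ _)).congr fun _ => rfl

/-- **Reading the returned ordering is typed polynomial time.** [folklore] -/
theorem codeFP_headOrd : CodeFP (rawE frameE) (rawE natE) headOrd := by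
  have hcons : CodeFP (pairE unitE (pairE frameE (rawE frameE))) (rawE natE) (fun t => (tupleOf t.2.1).2.2.2.2.2.2.2.2.2) :=
    (codeFP_tupleOf.comp (snd _ _).fst').snd'.snd'.snd'.snd'.snd'.snd'.snd'.snd'.snd'
  have h := rawCases (eσ := unitE) (eα := frameE) (eδ := rawE natE) (k := fun _ l => headOrd l) (gnil := fun _ => [])
    (const _ []) hcons (fun _ => rfl) (fun _ _ _ => rfl)
  exact (h.comp ((const _ ()).pair (CodeFP.id _))).congr fun _ => rfl

/-- **The output from an ordering is typed polynomial time**: input `(s, ord)`. [cite: AroraBarakCC2009, §1.3] -/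
theorem codeFP_outOf' : CodeFP (pairE pinE (rawE natE)) ginE (fun t => outOf' t.1 t.2) := by
  have hn : CodeFP (pairE pinE (rawE natE)) unE (fun t => nOf t.1) := codeFP_nOf.comp (fst _ _)
  have hcode : CodeFP (pairE pinE (rawE natE)) codeTE (fun t => codeL (rowsOf t.1) (colsOf t.1) t.2) :=
    (codeFP_codeL.comp ((((codeFP_rowsOf.comp (fst _ _)).pair (codeFP_colsOf.comp (fst _ _)))).pair (snd _ _))).congr fun _ => rfl
  have hrows : CodeFP (pairE pinE (rawE natE)) strE (fun t => (codeL (rowsOf t.1) (colsOf t.1) t.2).1.flatten) := strFlatten.comp hcode.fst'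
  exact (((natOfUn.comp hn).pair hrows).pair (hn.pair hcode.snd')).congr fun _ => rfl

end CGProg

end Literature.Computability.Complexity
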